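import Literature.MathematicalPhysics.QuantumFieldTheory.Balaban1983to89.B9Eq3115KnitLetterY
import Literature.MathematicalPhysics.QuantumFieldTheory.Balaban1983to89.B7Prop4LinCovIterClosedLaws
import Literature.MathematicalPhysics.QuantumFieldTheory.Balaban1983to89.B9B8KnitLetterCovariance
import Literature.MathematicalPhysics.QuantumFieldTheory.Balaban1983to89.B9C2LettersTorusYCov

/-!
# `Balaban1983to89.B9Eq3115KnitLetterYLaws` — T. Bałaban, *Propagators for lattice gauge theories in a background field*, Commun. Math. Phys. **99** (1985)
# 389–434 [Balaban1985BackgroundPropagators] (3.12)–(3.15) p. 393, (3.28)–(3.32) pp. 395–396, p. 391; T. Bałaban, *Averaging operations for lattice gauge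
# theories*, Commun. Math. Phys. **98** (1985) 17–51 [Balaban1985Averaging] p. 24, p. 31, (11) p. 19: THE LAWS OF PRINT's AVERAGING LETTER `QknitY` ON
# NODE 00's CARRIERS — (L2) LOCALITY, (L5) GAUGE COVARIANCE KEYED AT THE BLOCK CORNER (`gSrcCornerY`, the key of record of `C⁽²⁾`), (L4) REALITY

statement-level skeleton of published theorems with citation tags; proofs where landed; nothing here is a claim about the
Yang–Mills mass gap

PDFs held: `paper:balaban1985-cmp99-background-propagators`, `paper:balaban1985-cmp98-averaging`; read through the verbatim quotations of the files cited.

CITATION HEADER (lean-in-tree rule).  Cell `pub-ymgap`, seat `pub-ymgap-dag-n06-l` (gen 35; K1⁹ `stmt-QuantumFields-27364` SUPPORTS lane), programme P-Q15 file 4 —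
the def-Y-carrier forms of file 3's laws, in the shapes of node00-def-Y's `R2-REPIN-DESIGN.md` §3 ((L2) `QY_apply_congr`-type, (L5) `QY_cov`-type `Intw`,
(L4) `QY_isRealOpY`-type `IsRealOpY`).  REUSED BY NAME, nothing restated: files 1–3 (`linCovIterC`, `QknitY`, `linCovIterC_congr ∕ _rot ∕ star_linCovIterC_eq_neg`),
J-B (`B9B8KnitLetterCovariance.liftCfg_gaugeY`, `B9B8CarrierDictionary.liftFun`, `B9B8KnitBondTransfer.liftBd`), def-Y (`Node00.OpsYGauge.Intw ∕ conjY ∕ gaugeY ∕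
gBondY`, `Node00.OpsYSectDReal.IsRealOpY`), this seat's g34 key of record (`B9C2LettersTorusYCov.gSrcCornerY ∕ srcCornerY`, `B9C2LettersTorusY.zOf`),
b07 (`B7Prop1Local.AgreeOn ∕ InBox ∕ loK ∕ bondHiK`, `B7AvgGaugeCovariance.uLev`, `B7Prop1Explicit.U1 ∕ gaugeAct`).

THE PRINT.  [5] p. 24 *«Ū^k_c … depends only on the bond variables U_b for b ⊂ B^k(c₋) ∪ B^k(c₊)»*, p. 31 *«the same locality properties»*; [B9] (3.32)
*«Q_j(U^u)R(u) = R(u)Q_j(U)»* (pp. 395–396, *«the equalities (3.32) hold again»*), the coarse `u` read at the coarse lattice point = the block's representative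
(corner, [5] (7)∕(11)); p. 391 *«hermitian matrices»*.

WHAT IS DEFINED AND PROVED (sorry-free; no new definition; no estimate of the papers).
* §1 (L2) ★ `QknitY_apply_congr` — `(Q(U)a)(ι) = (Q(U′)a′)(ι)` whenever `U, U′` and `a, a′` agree on the fine bonds of `B^j(ι₋) ∪ B^j(ι₊)` (stated on the periodic
  readings: the box `[Lʲz_ι, Lʲz_ι + (Lʲ−1)𝟙 + Lʲe_κ]` of `ℤ^{d+1}` read on the torus through `0 + ·`), at EVERY background.
* §2 (L5) `liftBd_conjY_gBondY` (dictionary), `uLev_liftFun_zSrc` (the B7 chain's corner key `u_j(z_ι)` IS `gSrcCornerY i g ι`, the key of record of `C⁽²⁾`),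
  ★★ `QknitY_cov` — `Intw (conjY (gBondY i g)) (conjY (gSrcCornerY i g)) (QknitY i U) (QknitY i (gaugeY i g U))`, i.e. `Q(U^g)(R(g)a) = R(g∘corner)(Q(U)a)`, at EVERY
  background, for gauge functions with `|g|, |g⁻¹| ≤ 1`; `QknitY_gaugeY_apply` (pointwise form); `QknitY_cov_unitary` (unitary `g`, `𝔸 = M_N(ℂ)`).
* §3 (L4) `isRealOpY_of_skew` (a `ℂ`-linear operator mapping skew fields to skew fields is real), ★★ `QknitY_isRealOpY` — `IsRealOpY (QknitY i U)` for `U` `G`-valued,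
  `G ≤ U(N)` averaging-closed, in [5] Prop. 2's class with `4α₀ ≤ c₂′` and the displayed α₀-smallness `exp(3200(d+1)²(d+4)α₀) < 2` (a real scaling of the field
  brings g34's field-size hypotheses into force; reality is homogeneous under real scalars).

HONEST SCOPE.  Bookkeeping over files 1–3 and the landed dictionaries; (L2)∕(L5) hold at every background (the gate is local and gauge invariant), (L4) on the class;
(L6) onto ∕ (L7) sizes are NOT here (estimates).  Count-neutral; N06 NOT discharged; nothing continuum ∕ ℝ⁴ ∕ OS ∕ mass gap ∕ Clay — the Yang–Mills mass gap is NOT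
proved here.  NEW file; nothing landed is modified.  No `sorry`, no `axiom`, no `instance`, no `notation`.  Net new unproved facts: 0.
-/

noncomputable section

open scoped BigOperators

namespace Literature.MathematicalPhysics.QuantumFieldTheory.Balaban1983to89.B9Eq3115KnitLetterYLaws

open B7Prop1Explicit renaming Site → LSite
open B7Prop1Explicit (e gaugeAct U1)
open B7Prop1Local (AgreeOn InBox loK bondHiK)
open B7Eq78Linearization (conjR conjR_apply)
open B7Prop2Explicit (avgIter AvgClosed pdev C0 c2' unitaryUnits)
open B7Prop3Flat (c3)
open B7AvgGaugeCovariance (uLev uLev_apply)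
open B7AvgPeriodicity (proj)
open B7Prop4LinCovIterClosed (linCovIterC linCovIterC_smul)
open B7Prop4LinCovIterClosedLaws (linCovIterC_congr linCovIterC_rot star_linCovIterC_eq_neg)
open B10Eq27TorusAxialLog (transl transl_apply)
open B6GlobalChartV1 (PV)
open B6KLevelCensusIndexV1 (KIdx)
open B9B8CarrierDictionary (liftFun liftFun_apply liftCfg liftCfg_apply liftCfg_mem conjR_eq_R)
open B9B8KnitBondTransfer (liftBd liftBd_apply)
open B9B8KnitLetterCovariance (liftCfg_gaugeY)
open B9Eq3115KnitLetterY (zSrc QknitY QknitY_apply liftBd_smul norm_liftBd_le lvl_le')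
open B9C2LettersTorusY (T0 zOf)
open B9C2LettersTorusYCov (srcCornerY gSrcCornerY gSrcCornerY_apply)
open B9Eq39Adjoint (R)
open Node00

variable {d ℓ : ℕ} {hd : 1 ≤ d + 1} {hL : Odd (ℓ + 1) ∧ 1 < ℓ + 1} {b₀ b₁ : ℝ}

/-! ## §1 (L2) Locality -/

section Locality

variable {𝔸 : Type} [NormedRing 𝔸] [NormOneClass 𝔸] [NormedAlgebra ℂ 𝔸] [CompleteSpace 𝔸]
variable (i : KIdx d ℓ hd hL b₀ b₁)

/-- ★ **(L2) LOCALITY OF `QknitY`**: `(Q(U)a)(ι)` depends only on `U` and `a` on the fine bonds of `B^j(ι₋) ∪ B^j(ι₊)` — in the periodic reading: the bonds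
`⟨0 + x, μ⟩` with `x`, `x + e_μ` in the box `[Lʲz_ι, Lʲz_ι + (Lʲ − 1)𝟙 + Lʲe_κ]` of `ℤ^{d+1}` (`loK ∕ bondHiK`) — at EVERY background (file 3's `linCovIterC_congr`).
[cite: Balaban1985Averaging, p.24 (after (43)), p.31 (after (91)); Balaban1985BackgroundPropagators, (3.12)–(3.15) p.393] -/
theorem QknitY_apply_congr {U U' : CfgY 𝔸 i} {a a' : FBondY i → 𝔸} (ι : IBondY i)
    (hU : ∀ (x : LSite (d + 1)) (μ : Fin (d + 1)), InBox (loK (ℓ + 1) (ι.1.1 : ℕ) (zSrc i ι)) (bondHiK (ℓ + 1) (ι.1.1 : ℕ) (zSrc i ι) ι.1.2.dir) x →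
      InBox (loK (ℓ + 1) (ι.1.1 : ℕ) (zSrc i ι)) (bondHiK (ℓ + 1) (ι.1.1 : ℕ) (zSrc i ι) ι.1.2.dir) (x + e μ) →
        U μ (transl (0 : Site (PV d ℓ i.m i.K hd hL) 0) x) = U' μ (transl (0 : Site (PV d ℓ i.m i.K hd hL) 0) x))
    (ha : ∀ (x : LSite (d + 1)) (μ : Fin (d + 1)), InBox (loK (ℓ + 1) (ι.1.1 : ℕ) (zSrc i ι)) (bondHiK (ℓ + 1) (ι.1.1 : ℕ) (zSrc i ι) ι.1.2.dir) x →
      InBox (loK (ℓ + 1) (ι.1.1 : ℕ) (zSrc i ι)) (bondHiK (ℓ + 1) (ι.1.1 : ℕ) (zSrc i ι) ι.1.2.dir) (x + e μ) →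
        a ⟨transl (0 : Site (PV d ℓ i.m i.K hd hL) 0) x, μ⟩ = a' ⟨transl (0 : Site (PV d ℓ i.m i.K hd hL) 0) x, μ⟩) :
    QknitY i U a ι = QknitY i U' a' ι := by
  rw [QknitY_apply, QknitY_apply,
    linCovIterC_congr (ℓ + 1) (Nat.succ_pos ℓ) (ι.1.1 : ℕ) (zSrc i ι) ι.1.2.dir (fun x μ hx hxe => ?_) (fun x μ hx hxe => ?_)]
  · rw [liftCfg_apply, liftCfg_apply, hU x μ hx hxe]
  · rw [liftBd_apply, liftBd_apply, ha x μ hx hxe]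

end Locality

/-! ## §2 (L5) Gauge covariance, keyed at the block corner -/

section Covariance

variable {𝔸 : Type} [NormedRing 𝔸] [NormOneClass 𝔸] [NormedAlgebra ℂ 𝔸] [CompleteSpace 𝔸]
variable (i : KIdx d ℓ hd hL b₀ b₁)

omit [NormOneClass 𝔸] in
/-- dictionary: the lift of the gauge-rotated bond function `R(g)a` is the B7 chain's rotated field `x ↦ R(g♯(x))a♯(x)`.
[cite: Balaban1985BackgroundPropagators, (3.28) p.395 («(R(u)A)(x, x′) = R(u(x))A(x, x′)»), dictionary] -/
theorem liftBd_conjY_gBondY (g : GaugeY 𝔸 i) (a : FBondY i → 𝔸) :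
    liftBd i (conjY (gBondY i g) a) = fun x κ => conjR (liftFun g x) (liftBd i a x κ) := rfl

omit [NormOneClass 𝔸] in
/-- ★ **ONE KEY**: the B7 chain's coarse gauge function `u_j(z_ι) = g♯(Lʲz_ι)` (the gauge function at the CORNER of the block `B^j(ι₋)`) IS `gSrcCornerY i g ι` — the
key of record of the `C⁽²⁾` letter (`B9C2LettersTorusYCov`, def-Y's `IsCovUC`). [cite: Balaban1985Averaging, (11) p.19, (7) p.19; Balaban1985BackgroundPropagators, (3.32) p.395] -/
theorem uLev_liftFun_zSrc (g : GaugeY 𝔸 i) (ι : IBondY i) :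
    uLev (ℓ + 1) (liftFun (P := PV d ℓ i.m i.K hd hL) g) (ι.1.1 : ℕ) (zSrc i ι) = gSrcCornerY i g ι := by
  rw [uLev_apply, liftFun_apply, gSrcCornerY_apply]
  congr 1
  funext ν
  rw [transl_apply, show (0 : Site (PV d ℓ i.m i.K hd hL) 0) ν = 0 from rfl, zero_add]
  rfl

/-- ★★ **(L5) GAUGE COVARIANCE OF `QknitY`, CORNER-KEYED, pointwise**: `(Q(U^g)(R(g)a))(ι) = R(g(corner of B^j(ι₋)))·(Q(U)a)(ι)` — (3.32) «Q_j(U^u)R(u) = R(u)Q_j(U)»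
on NODE 00's carriers, at EVERY background, for gauge functions with `|g|, |g⁻¹| ≤ 1` (file 3's `linCovIterC_rot` through J-B's `liftCfg_gaugeY`).
[cite: Balaban1985BackgroundPropagators, (3.32) pp.395–396, (3.28) p.395; Balaban1985Averaging, (11) p.19] -/
theorem QknitY_gaugeY_apply {g : GaugeY 𝔸 i} (hg : ∀ x, g x ∈ U1 𝔸) (U : CfgY 𝔸 i) (a : FBondY i → 𝔸) (ι : IBondY i) :
    QknitY i (gaugeY i g U) (conjY (gBondY i g) a) ι = R (gSrcCornerY i g ι) (QknitY i U a ι) := by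
  have hg' : ∀ x : LSite (d + 1), liftFun (P := PV d ℓ i.m i.K hd hL) g x ∈ U1 𝔸 := fun x => by
    rw [liftFun_apply]; exact hg _
  have hrot := linCovIterC_rot (ℓ + 1) (liftFun (P := PV d ℓ i.m i.K hd hL) g) hg' (liftCfg U) (liftBd i a) (ι.1.1 : ℕ) (zSrc i ι) ι.1.2.dir
  rw [QknitY_apply, QknitY_apply, liftCfg_gaugeY, liftBd_conjY_gBondY, hrot, uLev_liftFun_zSrc, conjR_eq_R, B9Eq39Adjoint.R_smul]

/-- ★★ **(L5) AS AN INTERTWINING LAW** (def-Y's `QY_cov` shape, corner key): `Intw (R(g) on bonds) (R(g∘corner) on index bonds) (Q(U)) (Q(U^g))`.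
[cite: Balaban1985BackgroundPropagators, (3.32) pp.395–396] -/
theorem QknitY_cov {g : GaugeY 𝔸 i} (hg : ∀ x, g x ∈ U1 𝔸) (U : CfgY 𝔸 i) :
    Intw (conjY (gBondY i g)) (conjY (gSrcCornerY i g)) (QknitY i U) (QknitY i (gaugeY i g U)) := by
  apply LinearMap.ext
  intro a
  funext ι
  rw [LinearMap.comp_apply, LinearMap.comp_apply, QknitY_gaugeY_apply i hg U a ι, conjY_apply]

end Covariance

/-! ## §3 (L4) Reality on [5] Proposition 2's class -/

section Reality

open scoped Matrix Matrix.Norms.L2Operator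

variable {N : ℕ} (i : KIdx d ℓ hd hL b₀ b₁)

/-- (L5) for UNITARY gauge functions at `𝔸 = M_N(ℂ)` (`U(N) ⊂ {|u| ≤ 1, |u⁻¹| ≤ 1}`): the shape def-Y's record consumes.
[cite: Balaban1985BackgroundPropagators, (3.28)–(3.32) pp.395–396] -/
theorem QknitY_cov_unitary [Nonempty (Fin N)] {g : GaugeY (Matrix (Fin N) (Fin N) ℂ) i}
    (hg : ∀ x, g x ∈ unitaryUnits (Matrix (Fin N) (Fin N) ℂ)) (U : CfgY (Matrix (Fin N) (Fin N) ℂ) i) :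
    Intw (conjY (gBondY i g)) (conjY (gSrcCornerY i g)) (QknitY i U) (QknitY i (gaugeY i g U)) := by
  letI : CStarAlgebra (Matrix (Fin N) (Fin N) ℂ) := {}
  exact QknitY_cov i (fun x => B7Prop2Explicit.unitaryUnits_le_U1 (hg x)) U

/-- **a `ℂ`-linear operator mapping skew fields to skew fields is REAL** (`T(Λ⋆) = (TΛ)⋆` for every `Λ`): split `Λ = h + s` into Hermitian and skew parts,
`h = I·(−I·h)` with `−I·h` skew. [cite: Balaban1985BackgroundPropagators, p.391 («hermitian matrices»), dictionary (D1) of `Node00.OpsYSectDReal`] -/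
theorem isRealOpY_of_skew {X Y : Type} [Fintype X] [Fintype Y] (T : (X → Matrix (Fin N) (Fin N) ℂ) →ₗ[ℂ] (Y → Matrix (Fin N) (Fin N) ℂ))
    (hT : ∀ s : X → Matrix (Fin N) (Fin N) ℂ, star s = -s → star (T s) = -T s) : IsRealOpY T := by
  intro Λ
  -- `2Λ = s₁ − I·s₂` with `s₁ = Λ − Λ⋆`, `s₂ = I·(Λ + Λ⋆)` both skew
  set s₁ : X → Matrix (Fin N) (Fin N) ℂ := Λ - star Λ with hs₁
  set s₂ : X → Matrix (Fin N) (Fin N) ℂ := Complex.I • (Λ + star Λ) with hs₂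
  have hI : (starRingEnd ℂ) Complex.I = -Complex.I := Complex.conj_I
  have h2 : (starRingEnd ℂ) (2 : ℂ) = 2 := map_ofNat _ 2
  have h₁ : star s₁ = -s₁ := by rw [hs₁, star_sub, star_star, neg_sub]
  have h₂ : star s₂ = -s₂ := by
    rw [hs₂, star_smul, Complex.star_def, hI, star_add, star_star, neg_smul, add_comm]
  have hΛ : (2 : ℂ) • Λ = s₁ - Complex.I • s₂ := by
    rw [hs₁, hs₂, smul_smul, Complex.I_mul_I, neg_one_smul, sub_neg_eq_add, two_smul]; abel
  have hΛs : (2 : ℂ) • star Λ = -s₁ - Complex.I • s₂ := by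
    rw [hs₁, hs₂, smul_smul, Complex.I_mul_I, neg_one_smul, sub_neg_eq_add, neg_sub, two_smul]; abel
  have e : T ((2 : ℂ) • star Λ) = star (T ((2 : ℂ) • Λ)) := by
    rw [hΛ, hΛs, map_sub, map_sub, map_neg, map_smul, star_sub, star_smul, Complex.star_def, hI, hT s₁ h₁, hT s₂ h₂,
      neg_smul, smul_neg, neg_neg]
  rw [map_smul, map_smul, star_smul, Complex.star_def, h2] at e
  exact smul_right_injective _ (two_ne_zero (α := ℂ)) e

/-- ★★ **(L4) REALITY OF `QknitY` ON [5] PROPOSITION 2's CLASS**: for `G ≤ U(N)` averaging-closed, `U` `G`-valued with `pdev U♯ < α₀L^{−2k}`, `C₀α₀ ≤ 1/3`, `4α₀ ≤ c₂′`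
and the displayed α₀-smallness `exp(3200(d+1)²(d+4)·α₀) < 2`, the letter `Q(U)` is real: `Q(U)(a⋆) = (Q(U)a)⋆` (skew fields go to skew fields by file 3's
`star_linCovIterC_eq_neg` after a real rescaling of the field small enough for g34's field-size hypotheses; `isRealOpY_of_skew`).
[cite: Balaban1985BackgroundPropagators, p.391 («hermitian matrices»), (3.12)–(3.15) p.393; Balaban1985Averaging, (22)–(23) p.21, (127) p.37] -/
theorem QknitY_isRealOpY [Nonempty (Fin N)] {G : Subgroup (Matrix (Fin N) (Fin N) ℂ)ˣ} (hGU : G ≤ unitaryUnits (Matrix (Fin N) (Fin N) ℂ))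
    (hG : AvgClosed (d + 1) (ℓ + 1) G) {U : CfgY (Matrix (Fin N) (Fin N) ℂ) i} (hU : ∀ μ x, U μ x ∈ G) {α₀ : ℝ} (hα : 0 < α₀)
    (hα3 : C0 (d + 1) * α₀ ≤ 1 / 3) (hα4 : 4 * α₀ ≤ c2' (d + 1) (ℓ + 1))
    (h52 : pdev (liftCfg U) < α₀ * ((((ℓ + 1 : ℕ) : ℝ) ^ i.k)⁻¹) ^ 2)
    (hexp : Real.exp (4 * (800 * (((d + 1 : ℕ) : ℝ) + 1) ^ 2 * (((d + 1 : ℕ) : ℝ) + 4)) * α₀) < 2) :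
    IsRealOpY (QknitY i U) := by
  letI : CStarAlgebra (Matrix (Fin N) (Fin N) ℂ) := {}
  have hL2 : 2 ≤ ℓ + 1 := hL.2
  refine isRealOpY_of_skew (QknitY i U) fun s hs => ?_
  -- sizes: the bound `b` of the skew field, g34's constants `E`, `K`, `Lᵏ`, and a real scale `ε` with `ε·b` below both thresholds
  set b : ℝ := ∑ f : FBondY i, ‖s f‖ with hb
  have hb0 : 0 ≤ b := Finset.sum_nonneg fun f _ => norm_nonneg (s f)
  set E : ℝ := Real.exp (4 * (800 * (((d + 1 : ℕ) : ℝ) + 1) ^ 2 * (((d + 1 : ℕ) : ℝ) + 4)) * α₀) with hE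
  have hE0 : 0 < E := Real.exp_pos _
  set K : ℝ := 8 * (131072 * (((d + 1 : ℕ) : ℝ) + 1) ^ 2) with hK
  have hK0 : 0 < K := by positivity
  set Lk : ℝ := (((ℓ + 1 : ℕ) : ℝ)) ^ i.k with hLk
  have hLk0 : 0 < Lk := by positivity
  have hc3 : 0 < c3 (d + 1) (ℓ + 1) := by rw [c3]; positivity
  set M : ℝ := min ((2 - E) / (E * K * Lk)) (c3 (d + 1) (ℓ + 1) / (2 * Lk)) with hM
  have hM0 : 0 < M := lt_min (div_pos (by linarith) (by positivity)) (div_pos hc3 (by positivity))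
  have hb1 : 0 < b + 1 := by linarith
  set ε : ℝ := M / (b + 1) with hε
  have hε0 : 0 < ε := div_pos hM0 hb1
  have hεb : ε * b ≤ M := by
    rw [hε, div_mul_eq_mul_div, div_le_iff₀ hb1]
    nlinarith
  have hεb0 : 0 ≤ ε * b := mul_nonneg hε0.le hb0
  have hsmall : E * (1 + K * (Lk * (ε * b))) ≤ 2 := by
    have h1 : ε * b ≤ (2 - E) / (E * K * Lk) := hεb.trans (min_le_left _ _)
    have h2 : E * K * Lk * (ε * b) ≤ 2 - E := by
      have := mul_le_mul_of_nonneg_left h1 (by positivity : 0 ≤ E * K * Lk)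
      rwa [mul_div_cancel₀ _ (by positivity : E * K * Lk ≠ 0)] at this
    nlinarith
  have hc₃ : 2 * (Lk * (ε * b)) ≤ c3 (d + 1) (ℓ + 1) := by
    have h1 : ε * b ≤ c3 (d + 1) (ℓ + 1) / (2 * Lk) := hεb.trans (min_le_right _ _)
    have h2 := mul_le_mul_of_nonneg_left h1 (by positivity : 0 ≤ 2 * Lk)
    rw [mul_div_cancel₀ _ (by positivity : 2 * Lk ≠ 0)] at h2
    calc 2 * (Lk * (ε * b)) = 2 * Lk * (ε * b) := by ring
      _ ≤ c3 (d + 1) (ℓ + 1) := h2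
  -- the rescaled lifted field is skew and bounded by `ε·b`
  have hBs : ∀ x κ, star (liftBd i (((ε : ℝ) : ℂ) • s) x κ) = -liftBd i (((ε : ℝ) : ℂ) • s) x κ := fun x κ => by
    rw [liftBd_apply, Pi.smul_apply, star_smul, Complex.star_def, Complex.conj_ofReal, ← smul_neg]
    congr 1
    exact congrFun hs _
  have hB : ∀ x κ, ‖liftBd i (((ε : ℝ) : ℂ) • s) x κ‖ ≤ ε * b := fun x κ => by
    rw [liftBd_smul, Pi.smul_apply, Pi.smul_apply, norm_smul, Complex.norm_real, Real.norm_of_nonneg hε0.le]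
    exact mul_le_mul_of_nonneg_left (norm_liftBd_le i s x κ) hε0.le
  have hV : ∀ x κ, liftCfg U x κ ∈ G := fun x κ => liftCfg_mem hU x κ
  -- g34's reality of the composite at the rescaled field, every index bond
  have hstar : ∀ ι : IBondY i, star (QknitY i U (((ε : ℝ) : ℂ) • s) ι) = -QknitY i U (((ε : ℝ) : ℂ) • s) ι := fun ι => by
    have h := star_linCovIterC_eq_neg (ℓ + 1) hL2 hG hGU i.k (liftCfg U) hV hα hα3 hα4 h52 (liftBd i (((ε : ℝ) : ℂ) • s)) hεb0 hB hBs
      hsmall hc₃ (ι.1.1 : ℕ) (lvl_le' i ι) (zSrc i ι) ι.1.2.dir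
    rw [QknitY_apply, star_smul, Complex.star_def, Complex.conj_ofReal, h, smul_neg]
  -- undo the scaling: `Q(U)` is `ℂ`-linear and `ε ≠ 0` is real
  funext ι
  have h := hstar ι
  rw [map_smul, Pi.smul_apply, star_smul, Complex.star_def, Complex.conj_ofReal, ← smul_neg] at h
  have hεC : ((ε : ℝ) : ℂ) ≠ 0 := Complex.ofReal_ne_zero.2 hε0.ne'
  rw [Pi.star_apply, Pi.neg_apply]
  exact smul_right_injective _ hεC h

end Reality

end Literature.MathematicalPhysics.QuantumFieldTheory.Balaban1983to89.B9Eq3115KnitLetterYLaws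

end
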